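import Summits.ValiantsHypothesis.ValiantsHypothesis.Theorems.BarrierLeverTropicalDetCertificateSuffices
import Summits.ValiantsHypothesis.ValiantsHypothesis.Theorems.BarrierLeverPrincipalMinorLayoutsNonsingularSuffices
import Summits.ValiantsHypothesis.ValiantsHypothesis.Theorems.BarrierLeverTransversalSufficesForPrincipal
import Summits.ValiantsHypothesis.ValiantsHypothesis.Theses.BarrierLever

/-!
# Route BarrierLever — the UT-D door: tropical-determinant certificates (item 19316) ⇒ TT ⇒ TNS ⇒ item 19717

Helper file (`--supports stmt-ValiantsHypothesis-19152`; cell valiant-natproofs, rung V4, 𝒟-side, prover seat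
val-np-p3). Closes NO item. Three one-line arrows assembling tree theorems:

* `transversalMinorLayoutsNonsingular_of_tropicalDetCertificates` : «every injective layout carries a
  tropical-determinant certificate `(D, π₀)`» (the signature of item 19316 `TropicalDetCertificatesExist`,
  inlined) ⇒ `Theses.BarrierLever.TransversalMinorLayoutsNonsingular` (TT, item 19152), by item 19315
  (`…TropicalDet.tropicalDetCertificateSuffices`, this seat);
* `principalMinorLayoutsNonsingular_of_tropicalDetCertificates` : … ⇒ TNS (item 19126), by item 19153
  (`…TransversalDictionary.transversalSufficesForPrincipal`, val-np-p1);
* `partitionMinorsHitByVP_of_tropicalDetCertificates` : … ⇒ `PartitionMinorsHitByVP` (item 19717), by item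
  19133 (`…PrincipalMinorWitness.partitionMinorsHitByVP_of_principalMinorLayoutsNonsingular`, prover gen 5).

So the planner's UT-D conjecture (item 19316; kit censuses h ≤ 7 clean) closes 19152, 19126 and 19717 by tree
theorems alone, in parallel to the CT door (`…PartitionMinorsHitByVPChain`) and to this seat's max-plus door
(`…ProductStateSums.partitionMinorsHitByVP_of_maxPlusCertificates`).

WHAT THIS IS NOT: 19316 is OPEN; nothing here is unconditional; nothing on crux stmt-14610 or `VP` vs `VNP`.
-/

-- layout Summits/ValiantsHypothesis/ValiantsHypothesis forces the duplicated namespace component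
set_option linter.dupNamespace false

namespace Summit.ValiantsHypothesis.ValiantsHypothesis.Theorems.BarrierLever.TropicalDet

/-- **UT-D ⇒ TT**: tropical-determinant certificates for all injective layouts (item 19316, inlined) give
`TransversalMinorLayoutsNonsingular` (item 19152). -/
theorem transversalMinorLayoutsNonsingular_of_tropicalDetCertificates
    (hcert : ∀ (h r : ℕ) (u w : Fin r → Finset (Fin h)), Function.Injective u → Function.Injective w →
      ∃ (D : Fin (h + h) → Fin (h + h) → ℕ) (π₀ : Equiv.Perm (Fin r)), ∀ σ : Equiv.Perm (Fin r), σ ≠ π₀ →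
        ∑ j, Finset.univ.inf' Finset.univ_nonempty (fun τ : Equiv.Perm (Fin h) => ∑ a : Fin h,
          D (if a ∈ u (π₀ j) then Fin.castAdd h a else Fin.natAdd h a)
            (if τ a ∈ w j then Fin.natAdd h (τ a) else Fin.castAdd h (τ a))) <
        ∑ j, Finset.univ.inf' Finset.univ_nonempty (fun τ : Equiv.Perm (Fin h) => ∑ a : Fin h,
          D (if a ∈ u (σ j) then Fin.castAdd h a else Fin.natAdd h a)
            (if τ a ∈ w j then Fin.natAdd h (τ a) else Fin.castAdd h (τ a)))) :
    Summit.ValiantsHypothesis.ValiantsHypothesis.Theses.BarrierLever.TransversalMinorLayoutsNonsingular := by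
  intro h r u w hu hw
  obtain ⟨D, π₀, hπ⟩ := hcert h r u w hu hw
  exact tropicalDetCertificateSuffices h r u w D _ (fun _ _ => rfl) π₀ hπ

/-- **UT-D ⇒ TNS** (item 19126), through item 19153. -/
theorem principalMinorLayoutsNonsingular_of_tropicalDetCertificates
    (hcert : ∀ (h r : ℕ) (u w : Fin r → Finset (Fin h)), Function.Injective u → Function.Injective w →
      ∃ (D : Fin (h + h) → Fin (h + h) → ℕ) (π₀ : Equiv.Perm (Fin r)), ∀ σ : Equiv.Perm (Fin r), σ ≠ π₀ →
        ∑ j, Finset.univ.inf' Finset.univ_nonempty (fun τ : Equiv.Perm (Fin h) => ∑ a : Fin h,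
          D (if a ∈ u (π₀ j) then Fin.castAdd h a else Fin.natAdd h a)
            (if τ a ∈ w j then Fin.natAdd h (τ a) else Fin.castAdd h (τ a))) <
        ∑ j, Finset.univ.inf' Finset.univ_nonempty (fun τ : Equiv.Perm (Fin h) => ∑ a : Fin h,
          D (if a ∈ u (σ j) then Fin.castAdd h a else Fin.natAdd h a)
            (if τ a ∈ w j then Fin.natAdd h (τ a) else Fin.castAdd h (τ a)))) :
    Summit.ValiantsHypothesis.ValiantsHypothesis.Theses.BarrierLever.PrincipalMinorLayoutsNonsingular :=
  TransversalDictionary.transversalSufficesForPrincipal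
    (transversalMinorLayoutsNonsingular_of_tropicalDetCertificates hcert)

/-- **UT-D ⇒ `PartitionMinorsHitByVP`** (item 19717), through items 19153 and 19133. -/
theorem partitionMinorsHitByVP_of_tropicalDetCertificates
    (hcert : ∀ (h r : ℕ) (u w : Fin r → Finset (Fin h)), Function.Injective u → Function.Injective w →
      ∃ (D : Fin (h + h) → Fin (h + h) → ℕ) (π₀ : Equiv.Perm (Fin r)), ∀ σ : Equiv.Perm (Fin r), σ ≠ π₀ →
        ∑ j, Finset.univ.inf' Finset.univ_nonempty (fun τ : Equiv.Perm (Fin h) => ∑ a : Fin h,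
          D (if a ∈ u (π₀ j) then Fin.castAdd h a else Fin.natAdd h a)
            (if τ a ∈ w j then Fin.natAdd h (τ a) else Fin.castAdd h (τ a))) <
        ∑ j, Finset.univ.inf' Finset.univ_nonempty (fun τ : Equiv.Perm (Fin h) => ∑ a : Fin h,
          D (if a ∈ u (σ j) then Fin.castAdd h a else Fin.natAdd h a)
            (if τ a ∈ w j then Fin.natAdd h (τ a) else Fin.castAdd h (τ a)))) :
    Summit.ValiantsHypothesis.ValiantsHypothesis.Theses.BarrierLever.PartitionMinorsHitByVP :=
  PrincipalMinorWitness.partitionMinorsHitByVP_of_principalMinorLayoutsNonsingular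
    (principalMinorLayoutsNonsingular_of_tropicalDetCertificates hcert)

end Summit.ValiantsHypothesis.ValiantsHypothesis.Theorems.BarrierLever.TropicalDet
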